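import Mathlib
import Literature.Analysis.FluidPDE.SuitableWeak
import Literature.Analysis.FluidPDE.WeakGradientSlicing
import Literature.Analysis.FluidPDE.DivCurlAnnihilator
import Literature.Analysis.FluidPDE.PoincareBall
import Summits.NavierStokesRegularity.NavierStokesRegularity.Theorems.EulerZoomLiouvillePowerGaugeEulerLiouvilleIrrotationalTools
import HarnessLib

/-!
# Crux `EulerZoomLiouville.PowerGaugeEulerLiouville` (stmt-NavierStokesRegularity-19832), stub `stub_nonSelfSimilarRest`:
# TIME-TESTED VELOCITY FIELDS `w_κ(x) = ∫ κ(t) u(t,x) dt` — Fubini, local integrability, `A`-gauge growth, and the harmonic kill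

Helper file (theorems only; `--supports stmt-NavierStokesRegularity-19832`; def-free; pure analysis).  Hand leafhand-ns-eulerzoomliouville-10 g3;
tools for the companion file `…WeakAntiEquivariantMember` (wrong-parity members are distributionally steady).

For `u` locally integrable on a slab `(−∞,T) × ℝ³` and a continuous time-cutoff `κ` compactly supported in `(−∞,T)`, the TIME-TESTED FIELD
`w_κ(x) = ∫ κ(t) u(t,x) dt` is locally integrable (`locallyIntegrable_timeTested`), pairs with continuous compactly supported fields by Fubini
(`integral_inner_timeTested`: `∫⟪w_κ, Φ⟫ = ∫∫ κ(t)⟪u(t,x), Φ(x)⟫`), inherits the growth `∫_{B_r}|w_κ|² ≤ M²|S|² sup_{t∈S} ∫_{B_r}|u(t)|²` from slice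
bounds (`lintegral_ball_timeTested_le`, Cauchy–Schwarz in time + Tonelli), and VANISHES as soon as it is weakly divergence-free, weakly
curl-free and of sub-volume quadratic growth (`timeTested_ae_eq_zero`: coordinates weakly harmonic by the tree's
`integral_laplacian_mul_inner_eq_zero_of_curlPair` [LemarieRieusset2016 Thm 4.4], then the tree's Liouville theorem
`ae_eq_zero_of_weaklyHarmonic_of_growth`).

WHAT THIS IS NOT: nothing about Euler or Navier–Stokes by itself; not a proof of any stub. [folklore]
-/

noncomputable section

-- flat `Theorems/<Route><Decl>…` files of one crux share the namespace of the crux (tree convention)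
set_option linter.dupNamespace false

open MeasureTheory Set Filter Topology Metric Function TopologicalSpace
open scoped RealInnerProductSpace NNReal ENNReal ContDiff Laplacian

namespace Summit.NavierStokesRegularity.NavierStokesRegularity.Theorems.PowerGaugeEulerLiouville

open Literature.Analysis Literature.Analysis.FunctionSpaces Literature.Analysis.FluidPDE

namespace AntiMember

variable {u : ℝ → EuclideanSpace ℝ (Fin 3) → EuclideanSpace ℝ (Fin 3)} {T : ℝ}

/-! ## 1. Vanishing of time-cutoffs and their derivatives above the slab -/

/-- A function with `tsupport θ ⊆ (−∞, T)` vanishes at every `t ≥ T`. [folklore] -/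
theorem eq_zero_of_tsupport_subset_Iio {θ : ℝ → ℝ} (hθT : tsupport θ ⊆ Iio T) {t : ℝ} (ht : T ≤ t) :
    θ t = 0 :=
  image_eq_zero_of_notMem_tsupport fun h => not_lt.2 ht (hθT h)

/-- … and so does its derivative. [folklore] -/
theorem deriv_eq_zero_of_tsupport_subset_Iio {θ : ℝ → ℝ} (hθT : tsupport θ ⊆ Iio T) {t : ℝ} (ht : T ≤ t) :
    deriv θ t = 0 := by
  have h : t ∉ tsupport (deriv θ) := fun h => not_lt.2 ht (hθT (tsupport_deriv_subset h))
  exact image_eq_zero_of_notMem_tsupport h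

/-- The derivative of a compactly supported smooth cutoff is continuous, compactly supported, with `tsupport ⊆ (−∞,T)`. [folklore] -/
theorem deriv_cutoff_props {θ : ℝ → ℝ} (hθ : ContDiff ℝ ∞ θ) (hθc : HasCompactSupport θ) (hθT : tsupport θ ⊆ Iio T) :
    Continuous (deriv θ) ∧ HasCompactSupport (deriv θ) ∧ tsupport (deriv θ) ⊆ Iio T :=
  ⟨hθ.continuous_deriv (by simp), hθc.deriv, tsupport_deriv_subset.trans hθT⟩

/-! ## 2. Integrability of the tested integrands on `ℝ × ℝ³` -/

/-- `κ(t) ⟪u(t,x), Φ(x)⟫` is integrable on `ℝ × ℝ³` for `u` locally integrable on the slab `(−∞,T) × ℝ³`, `κ` continuous compactly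
supported in `(−∞, T)` and `Φ` continuous compactly supported. [folklore] -/
theorem integrable_mul_inner_field
    (hu : LocallyIntegrableOn (uncurry u) (Iio T ×ˢ (univ : Set (EuclideanSpace ℝ (Fin 3)))) volume)
    {κ : ℝ → ℝ} (hκ : Continuous κ) (hκc : HasCompactSupport κ) (hκT : tsupport κ ⊆ Iio T)
    {Φ : EuclideanSpace ℝ (Fin 3) → EuclideanSpace ℝ (Fin 3)} (hΦ : Continuous Φ) (hΦc : HasCompactSupport Φ) :
    Integrable (fun z : ℝ × EuclideanSpace ℝ (Fin 3) => κ z.1 * ⟪u z.1 z.2, Φ z.2⟫)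
      (volume : Measure (ℝ × EuclideanSpace ℝ (Fin 3))) := by
  -- adapted from Literature/Analysis/FluidPDE/WeakGradientSlicing.lean (`integrable_mul_inner_of_locallyIntegrableOn`)
  set C : Set (ℝ × EuclideanSpace ℝ (Fin 3)) := tsupport κ ×ˢ tsupport Φ with hCdef
  have hC : IsCompact C := hκc.prod hΦc
  have hCQ : C ⊆ Iio T ×ˢ (univ : Set (EuclideanSpace ℝ (Fin 3))) := prod_mono hκT (subset_univ _)
  have huC : IntegrableOn (uncurry u) C volume := hu.integrableOn_compact_subset hCQ hC
  obtain ⟨M, hM⟩ := hκ.bounded_above_of_compact_support hκc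
  obtain ⟨N, hN⟩ := hΦ.bounded_above_of_compact_support hΦc
  have hsupp : support (fun z : ℝ × EuclideanSpace ℝ (Fin 3) => κ z.1 * ⟪u z.1 z.2, Φ z.2⟫) ⊆ C := by
    intro z hz
    by_contra hzC
    rcases not_and_or.1 (fun h => hzC (mem_prod.2 h)) with h | h
    · exact hz (by simp [image_eq_zero_of_notMem_tsupport h])
    · exact hz (by simp [image_eq_zero_of_notMem_tsupport h])
  refine (integrableOn_iff_integrable_of_support_subset hsupp).1 ?_
  have hmeas : AEStronglyMeasurable (fun z : ℝ × EuclideanSpace ℝ (Fin 3) => κ z.1 * ⟪u z.1 z.2, Φ z.2⟫)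
      (volume.restrict C) :=
    (hκ.comp continuous_fst).aestronglyMeasurable.mul
      (huC.aestronglyMeasurable.inner (hΦ.comp continuous_snd).aestronglyMeasurable)
  refine Integrable.mono' (huC.norm.mul_const (M * N)) hmeas ?_
  filter_upwards with z
  rw [norm_mul]
  calc ‖κ z.1‖ * ‖⟪u z.1 z.2, Φ z.2⟫‖ ≤ M * (‖u z.1 z.2‖ * N) :=
        mul_le_mul (hM z.1) ((norm_inner_le_norm _ _).trans (mul_le_mul_of_nonneg_left (hN z.2) (norm_nonneg _)))
          (norm_nonneg _) ((norm_nonneg _).trans (hM z.1))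
    _ = ‖uncurry u z‖ * (M * N) := by simp [uncurry]; ring

/-- `κ(t) ⟪u(t,x), Dη(x)[u(t,x)]⟫` is integrable on `ℝ × ℝ³` for `|u|²` locally integrable on the slab, `κ` continuous compactly supported in
`(−∞,T)` and `η` a `C¹` compactly supported field. [folklore] -/
theorem integrable_mul_inner_fderiv_apply
    (hum : AEStronglyMeasurable (uncurry u) (volume.restrict (Iio T ×ˢ (univ : Set (EuclideanSpace ℝ (Fin 3))))))
    (hu2 : LocallyIntegrableOn (fun z => ‖uncurry u z‖ ^ 2) (Iio T ×ˢ (univ : Set (EuclideanSpace ℝ (Fin 3)))) volume)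
    {κ : ℝ → ℝ} (hκ : Continuous κ) (hκc : HasCompactSupport κ) (hκT : tsupport κ ⊆ Iio T)
    {η : EuclideanSpace ℝ (Fin 3) → EuclideanSpace ℝ (Fin 3)} (hη : ContDiff ℝ 1 η) (hηc : HasCompactSupport η) :
    Integrable (fun z : ℝ × EuclideanSpace ℝ (Fin 3) => κ z.1 * ⟪u z.1 z.2, fderiv ℝ η z.2 (u z.1 z.2)⟫)
      (volume : Measure (ℝ × EuclideanSpace ℝ (Fin 3))) := by
  set C : Set (ℝ × EuclideanSpace ℝ (Fin 3)) := tsupport κ ×ˢ tsupport η with hCdef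
  have hC : IsCompact C := hκc.prod hηc
  have hCQ : C ⊆ Iio T ×ˢ (univ : Set (EuclideanSpace ℝ (Fin 3))) := prod_mono hκT (subset_univ _)
  have hu2C : IntegrableOn (fun z => ‖uncurry u z‖ ^ 2) C volume := hu2.integrableOn_compact_subset hCQ hC
  have hDη : Continuous (fderiv ℝ η) := hη.continuous_fderiv one_ne_zero
  have hDηc : HasCompactSupport (fderiv ℝ η) := hηc.fderiv (𝕜 := ℝ)
  obtain ⟨M, hM⟩ := hκ.bounded_above_of_compact_support hκc
  obtain ⟨N, hN⟩ := hDη.bounded_above_of_compact_support hDηc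
  have hsupp : support (fun z : ℝ × EuclideanSpace ℝ (Fin 3) => κ z.1 * ⟪u z.1 z.2, fderiv ℝ η z.2 (u z.1 z.2)⟫) ⊆ C := by
    intro z hz
    by_contra hzC
    rcases not_and_or.1 (fun h => hzC (mem_prod.2 h)) with h | h
    · exact hz (by simp [image_eq_zero_of_notMem_tsupport h])
    · exact hz (by simp [fderiv_of_notMem_tsupport (𝕜 := ℝ) h])
  refine (integrableOn_iff_integrable_of_support_subset hsupp).1 ?_
  have humC : AEStronglyMeasurable (uncurry u) (volume.restrict C) := hum.mono_set hCQ
  have happ : Continuous fun q : (EuclideanSpace ℝ (Fin 3) →L[ℝ] EuclideanSpace ℝ (Fin 3)) × EuclideanSpace ℝ (Fin 3) => q.1 q.2 :=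
    isBoundedBilinearMap_apply.continuous
  have hmeas1 : AEStronglyMeasurable (fun z : ℝ × EuclideanSpace ℝ (Fin 3) => fderiv ℝ η z.2 (u z.1 z.2)) (volume.restrict C) :=
    happ.comp_aestronglyMeasurable (((hDη.comp continuous_snd).aestronglyMeasurable).prodMk humC)
  have hmeas : AEStronglyMeasurable
      (fun z : ℝ × EuclideanSpace ℝ (Fin 3) => κ z.1 * ⟪u z.1 z.2, fderiv ℝ η z.2 (u z.1 z.2)⟫) (volume.restrict C) :=
    (hκ.comp continuous_fst).aestronglyMeasurable.mul (humC.inner hmeas1)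
  refine Integrable.mono' (hu2C.mul_const (M * N)) hmeas ?_
  filter_upwards with z
  rw [norm_mul]
  have h1 : ‖⟪u z.1 z.2, fderiv ℝ η z.2 (u z.1 z.2)⟫‖ ≤ ‖u z.1 z.2‖ ^ 2 * N := by
    refine (norm_inner_le_norm _ _).trans ?_
    have h2 : ‖fderiv ℝ η z.2 (u z.1 z.2)‖ ≤ N * ‖u z.1 z.2‖ :=
      (ContinuousLinearMap.le_opNorm _ _).trans (mul_le_mul_of_nonneg_right (hN z.2) (norm_nonneg _))
    calc ‖u z.1 z.2‖ * ‖fderiv ℝ η z.2 (u z.1 z.2)‖ ≤ ‖u z.1 z.2‖ * (N * ‖u z.1 z.2‖) :=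
          mul_le_mul_of_nonneg_left h2 (norm_nonneg _)
      _ = ‖u z.1 z.2‖ ^ 2 * N := by ring
  calc ‖κ z.1‖ * ‖⟪u z.1 z.2, fderiv ℝ η z.2 (u z.1 z.2)⟫‖ ≤ M * (‖u z.1 z.2‖ ^ 2 * N) :=
        mul_le_mul (hM z.1) h1 (norm_nonneg _) ((norm_nonneg _).trans (hM z.1))
    _ = ‖uncurry u z‖ ^ 2 * (M * N) := by simp [uncurry]; ring

/-! ## 3. The time-tested field `w_κ(x) = ∫ κ(t) u(t,x) dt`: Fubini, local integrability, growth -/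

/-- `κ(t) u(t,x)` is integrable on `ℝ × K` for every compact `K ⊆ ℝ³`. [folklore] -/
theorem integrable_smul_prod
    (hu : LocallyIntegrableOn (uncurry u) (Iio T ×ˢ (univ : Set (EuclideanSpace ℝ (Fin 3)))) volume)
    {κ : ℝ → ℝ} (hκ : Continuous κ) (hκc : HasCompactSupport κ) (hκT : tsupport κ ⊆ Iio T)
    {K : Set (EuclideanSpace ℝ (Fin 3))} (hK : IsCompact K) :
    Integrable (fun z : ℝ × EuclideanSpace ℝ (Fin 3) => κ z.1 • u z.1 z.2)
      ((volume : Measure ℝ).prod (volume.restrict K)) := by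
  have e : (volume : Measure ℝ).prod ((volume : Measure (EuclideanSpace ℝ (Fin 3))).restrict K) =
      (volume : Measure (ℝ × EuclideanSpace ℝ (Fin 3))).restrict ((univ : Set ℝ) ×ˢ K) := by
    rw [Measure.volume_eq_prod, ← Measure.prod_restrict, Measure.restrict_univ]
  rw [e]
  change IntegrableOn (fun z : ℝ × EuclideanSpace ℝ (Fin 3) => κ z.1 • u z.1 z.2) ((univ : Set ℝ) ×ˢ K) volume
  set C : Set (ℝ × EuclideanSpace ℝ (Fin 3)) := tsupport κ ×ˢ K with hCdef
  have hC : IsCompact C := hκc.prod hK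
  have hCQ : C ⊆ Iio T ×ˢ (univ : Set (EuclideanSpace ℝ (Fin 3))) := prod_mono hκT (subset_univ _)
  have huC : IntegrableOn (uncurry u) C volume := hu.integrableOn_compact_subset hCQ hC
  have h1 : IntegrableOn (fun z : ℝ × EuclideanSpace ℝ (Fin 3) => κ z.1 • u z.1 z.2) C volume :=
    IntegrableOn.continuousOn_smul huC (hκ.comp continuous_fst).continuousOn hC
  refine h1.of_forall_sdiff_eq_zero (MeasurableSet.univ.prod hK.measurableSet) ?_
  rintro ⟨t, x⟩ ⟨htx, hz⟩
  have ht : t ∉ tsupport κ := fun ht => hz ⟨ht, (mem_prod.1 htx).2⟩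
  simp [image_eq_zero_of_notMem_tsupport ht]

/-- For a.e. `x`, `t ↦ κ(t) u(t,x)` is integrable. [folklore] -/
theorem ae_integrable_smul
    (hu : LocallyIntegrableOn (uncurry u) (Iio T ×ˢ (univ : Set (EuclideanSpace ℝ (Fin 3)))) volume)
    {κ : ℝ → ℝ} (hκ : Continuous κ) (hκc : HasCompactSupport κ) (hκT : tsupport κ ⊆ Iio T) :
    ∀ᵐ x ∂(volume : Measure (EuclideanSpace ℝ (Fin 3))), Integrable (fun t => κ t • u t x) (volume : Measure ℝ) := by
  have h : ∀ n : ℕ, ∀ᵐ x ∂((volume : Measure (EuclideanSpace ℝ (Fin 3))).restrict (closedBall 0 n)),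
      Integrable (fun t => κ t • u t x) (volume : Measure ℝ) := fun n =>
    (integrable_smul_prod hu hκ hκc hκT (isCompact_closedBall (0 : EuclideanSpace ℝ (Fin 3)) n)).prod_left_ae
  have h2 : ∀ᵐ x ∂((volume : Measure (EuclideanSpace ℝ (Fin 3))).restrict (⋃ n : ℕ, closedBall 0 n)),
      Integrable (fun t => κ t • u t x) (volume : Measure ℝ) := (ae_restrict_iUnion_iff _ _).2 h
  rwa [iUnion_closedBall_nat, Measure.restrict_univ] at h2

/-- The time-tested field is locally integrable. [folklore] -/
theorem locallyIntegrable_timeTested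
    (hu : LocallyIntegrableOn (uncurry u) (Iio T ×ˢ (univ : Set (EuclideanSpace ℝ (Fin 3)))) volume)
    {κ : ℝ → ℝ} (hκ : Continuous κ) (hκc : HasCompactSupport κ) (hκT : tsupport κ ⊆ Iio T) :
    LocallyIntegrable (fun x => ∫ t, κ t • u t x) (volume : Measure (EuclideanSpace ℝ (Fin 3))) := by
  refine locallyIntegrable_iff.2 fun K hK => ?_
  exact (integrable_smul_prod hu hκ hκc hκT hK).integral_prod_right

/-- **Fubini for the time-tested field**: `∫ ⟪w_κ, Φ⟫ dx = ∫∫ κ(t) ⟪u(t,x), Φ(x)⟫`. [folklore] -/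
theorem integral_inner_timeTested
    (hu : LocallyIntegrableOn (uncurry u) (Iio T ×ˢ (univ : Set (EuclideanSpace ℝ (Fin 3)))) volume)
    {κ : ℝ → ℝ} (hκ : Continuous κ) (hκc : HasCompactSupport κ) (hκT : tsupport κ ⊆ Iio T)
    {Φ : EuclideanSpace ℝ (Fin 3) → EuclideanSpace ℝ (Fin 3)} (hΦ : Continuous Φ) (hΦc : HasCompactSupport Φ) :
    ∫ x, ⟪(∫ t, κ t • u t x), Φ x⟫ = ∫ z : ℝ × EuclideanSpace ℝ (Fin 3), κ z.1 * ⟪u z.1 z.2, Φ z.2⟫ := by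
  have hF := integrable_mul_inner_field hu hκ hκc hκT hΦ hΦc
  rw [Measure.volume_eq_prod] at hF
  have e1 : ∫ z : ℝ × EuclideanSpace ℝ (Fin 3), κ z.1 * ⟪u z.1 z.2, Φ z.2⟫ =
      ∫ x, ∫ t, κ t * ⟪u t x, Φ x⟫ := by
    rw [Measure.volume_eq_prod, integral_prod_symm _ hF]
  rw [e1]
  refine integral_congr_ae ?_
  filter_upwards [ae_integrable_smul hu hκ hκc hκT] with x hx
  rw [real_inner_comm, ← integral_inner hx (Φ x)]
  refine integral_congr_ae (Eventually.of_forall fun t => ?_)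
  simp only [real_inner_smul_right, real_inner_comm]

/-- **Growth of the time-tested field from slice bounds.**  If `κ` is continuous with `|κ| ≤ M`, vanishing off the window `S = (a, b)`, and the
slices satisfy `∫_{B_r} |u(t)|² ≤ B` for every `t ∈ S`, then `∫_{B_r} |w_κ|² ≤ M² |S|² B`. [folklore] -/
theorem lintegral_ball_timeTested_le
    (hum : AEStronglyMeasurable (uncurry u) (volume.restrict (Iio T ×ˢ (univ : Set (EuclideanSpace ℝ (Fin 3))))))
    {κ : ℝ → ℝ} {a b : ℝ} (hbT : b ≤ T) (hκS : ∀ t ∉ Ioo a b, κ t = 0)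
    {M : ℝ} (hM : ∀ t, ‖κ t‖ ≤ M) {r : ℝ} {B : ℝ≥0∞}
    (hB : ∀ t ∈ Ioo a b, ∫⁻ x in ball (0 : EuclideanSpace ℝ (Fin 3)) r, ‖u t x‖ₑ ^ 2 ≤ B) :
    ∫⁻ x in ball (0 : EuclideanSpace ℝ (Fin 3)) r, ‖∫ t, κ t • u t x‖ₑ ^ 2 ≤
      ENNReal.ofReal (M ^ 2) * ENNReal.ofReal (b - a) * (ENNReal.ofReal (b - a) * B) := by
  set S : Set ℝ := Ioo a b with hSdef
  have hM0 : 0 ≤ M := (norm_nonneg _).trans (hM a)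
  -- measurability of `(t,x) ↦ u t x` on `S × ℝ³` and of a.e. section `t ↦ u t x`
  have hSQ : S ×ˢ (univ : Set (EuclideanSpace ℝ (Fin 3))) ⊆ Iio T ×ˢ (univ : Set (EuclideanSpace ℝ (Fin 3))) :=
    prod_mono (fun t ht => lt_of_lt_of_le ht.2 hbT) Subset.rfl
  have humS : AEStronglyMeasurable (uncurry u)
      (((volume : Measure ℝ).restrict S).prod (volume : Measure (EuclideanSpace ℝ (Fin 3)))) := by
    have := hum.mono_set hSQ
    rwa [Measure.volume_eq_prod, ← Measure.prod_restrict, Measure.restrict_univ] at this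
  have hsec : ∀ᵐ x ∂(volume : Measure (EuclideanSpace ℝ (Fin 3))),
      AEStronglyMeasurable (fun t => u t x) ((volume : Measure ℝ).restrict S) := humS.prodMk_right
  -- pointwise bound for a.e. `x`
  have hpt : ∀ᵐ x ∂(volume : Measure (EuclideanSpace ℝ (Fin 3))),
      ‖∫ t, κ t • u t x‖ₑ ^ 2 ≤ ENNReal.ofReal (M ^ 2) * ENNReal.ofReal (b - a) * ∫⁻ t in S, ‖u t x‖ₑ ^ 2 := by
    filter_upwards [hsec] with x hx
    have h1 : ‖∫ t, κ t • u t x‖ₑ ≤ ∫⁻ t, ‖κ t • u t x‖ₑ := enorm_integral_le_lintegral_enorm _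
    have h2 : ∫⁻ t, ‖κ t • u t x‖ₑ = ∫⁻ t in S, ‖κ t • u t x‖ₑ := by
      refine (setLIntegral_eq_of_support_subset fun t ht => ?_).symm
      by_contra hts
      exact ht (by simp [hκS t hts])
    have h3 : ∫⁻ t in S, ‖κ t • u t x‖ₑ ≤ ENNReal.ofReal M * ∫⁻ t in S, ‖u t x‖ₑ := by
      rw [← lintegral_const_mul' _ _ ENNReal.ofReal_ne_top]
      refine lintegral_mono fun t => ?_
      rw [enorm_smul]
      gcongr
      rw [← ofReal_norm]
      exact ENNReal.ofReal_le_ofReal (hM t)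
    have h4 : (∫⁻ t in S, ‖u t x‖ₑ) ^ 2 ≤ ENNReal.ofReal (b - a) * ∫⁻ t in S, ‖u t x‖ₑ ^ 2 := by
      have := PoincareBall.sq_lintegral_le_measure_mul_lintegral_sq ((volume : Measure ℝ).restrict S) hx.aemeasurable.enorm
      rwa [Measure.restrict_apply_univ, hSdef, Real.volume_Ioo] at this
    calc ‖∫ t, κ t • u t x‖ₑ ^ 2 ≤ (ENNReal.ofReal M * ∫⁻ t in S, ‖u t x‖ₑ) ^ 2 := by
          gcongr
          exact h1.trans (h2.le.trans h3)
      _ = ENNReal.ofReal (M ^ 2) * (∫⁻ t in S, ‖u t x‖ₑ) ^ 2 := by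
          rw [mul_pow, ← ENNReal.ofReal_pow hM0]
      _ ≤ ENNReal.ofReal (M ^ 2) * (ENNReal.ofReal (b - a) * ∫⁻ t in S, ‖u t x‖ₑ ^ 2) := by gcongr
      _ = _ := by rw [mul_assoc]
  -- integrate over the ball and swap (Tonelli)
  have hmeas2 : AEMeasurable (fun z : ℝ × EuclideanSpace ℝ (Fin 3) => ‖u z.1 z.2‖ₑ ^ 2)
      (((volume : Measure ℝ).restrict S).prod ((volume : Measure (EuclideanSpace ℝ (Fin 3))).restrict (ball 0 r))) := by
    have h1 : AEStronglyMeasurable (uncurry u)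
        (((volume : Measure ℝ).restrict S).prod ((volume : Measure (EuclideanSpace ℝ (Fin 3))).restrict (ball 0 r))) :=
      humS.mono_measure (Measure.prod_mono le_rfl Measure.restrict_le_self)
    exact (h1.enorm.pow_const 2)
  calc ∫⁻ x in ball (0 : EuclideanSpace ℝ (Fin 3)) r, ‖∫ t, κ t • u t x‖ₑ ^ 2
      ≤ ∫⁻ x in ball (0 : EuclideanSpace ℝ (Fin 3)) r,
          ENNReal.ofReal (M ^ 2) * ENNReal.ofReal (b - a) * ∫⁻ t in S, ‖u t x‖ₑ ^ 2 :=
        lintegral_mono_ae (ae_restrict_of_ae hpt)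
    _ = ENNReal.ofReal (M ^ 2) * ENNReal.ofReal (b - a) *
          ∫⁻ x in ball (0 : EuclideanSpace ℝ (Fin 3)) r, ∫⁻ t in S, ‖u t x‖ₑ ^ 2 := by
        rw [lintegral_const_mul' _ _ (ENNReal.mul_ne_top ENNReal.ofReal_ne_top ENNReal.ofReal_ne_top)]
    _ = ENNReal.ofReal (M ^ 2) * ENNReal.ofReal (b - a) *
          ∫⁻ t in S, ∫⁻ x in ball (0 : EuclideanSpace ℝ (Fin 3)) r, ‖u t x‖ₑ ^ 2 := by
        have hsw : AEMeasurable (uncurry fun (x : EuclideanSpace ℝ (Fin 3)) (t : ℝ) => ‖u t x‖ₑ ^ 2)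
            (((volume : Measure (EuclideanSpace ℝ (Fin 3))).restrict (ball 0 r)).prod ((volume : Measure ℝ).restrict S)) :=
          hmeas2.prod_swap
        rw [lintegral_lintegral_swap hsw]
    _ ≤ ENNReal.ofReal (M ^ 2) * ENNReal.ofReal (b - a) * ∫⁻ t in S, B := by
        gcongr ?_ * ?_
        · exact le_rfl
        · exact lintegral_mono_ae ((ae_restrict_iff' measurableSet_Ioo).2 (Eventually.of_forall hB))
    _ = _ := by rw [setLIntegral_const, hSdef, Real.volume_Ioo, mul_comm B]

/-! ## 4. The harmonic kill: a weakly curl- and divergence-free time-tested field of sub-volume growth vanishes -/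

/-- The gradient of a scalar test function is a continuous compactly supported field. [folklore] -/
theorem gradient_test_props {g : EuclideanSpace ℝ (Fin 3) → ℝ} (hg : IsTestFunctionOn (⊤ : Opens (EuclideanSpace ℝ (Fin 3))) g) :
    Continuous (gradient g) ∧ HasCompactSupport (gradient g) := by
  have h1 : Continuous (fderiv ℝ g) := hg.contDiff.continuous_fderiv (by simp)
  refine ⟨(InnerProductSpace.toDual ℝ (EuclideanSpace ℝ (Fin 3))).symm.continuous.comp h1, ?_⟩
  exact (hg.hasCompactSupport.fderiv (𝕜 := ℝ)).comp_left (g := (InnerProductSpace.toDual ℝ (EuclideanSpace ℝ (Fin 3))).symm)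
    (map_zero _)

/-- **THE TIME-TESTED FIELD VANISHES.**  If `∫∫ κ(t)⟪u, ∇g⟫ = 0` (incompressibility) and `∫∫ κ(t)⟪u, (∂ₐg)c − (∂_c g)a⟫ = 0` (weak curl-freeness
of `w_κ`) for all scalar test functions `g`, and `∫_{B_r}|w_κ|² ≤ K r^m` for `r > r₀` with `m < 3`, then `w_κ = 0` a.e.: every coordinate of `w_κ` is
weakly harmonic (tree `integral_laplacian_mul_inner_eq_zero_of_curlPair`) of sub-volume growth (tree `ae_eq_zero_of_weaklyHarmonic_of_growth`).
[folklore; LemarieRieusset2016 Thm 4.4] -/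
theorem timeTested_ae_eq_zero
    (hu : LocallyIntegrableOn (uncurry u) (Iio T ×ˢ (univ : Set (EuclideanSpace ℝ (Fin 3)))) volume)
    {κ : ℝ → ℝ} (hκ : Continuous κ) (hκc : HasCompactSupport κ) (hκT : tsupport κ ⊆ Iio T)
    (hdiv : ∀ g : EuclideanSpace ℝ (Fin 3) → ℝ, IsTestFunctionOn (⊤ : Opens (EuclideanSpace ℝ (Fin 3))) g →
      ∫ z : ℝ × EuclideanSpace ℝ (Fin 3), κ z.1 * ⟪u z.1 z.2, gradient g z.2⟫ = 0)
    (hcurl : ∀ g : EuclideanSpace ℝ (Fin 3) → ℝ, IsTestFunctionOn (⊤ : Opens (EuclideanSpace ℝ (Fin 3))) g →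
      ∀ a c : EuclideanSpace ℝ (Fin 3),
        ∫ z : ℝ × EuclideanSpace ℝ (Fin 3), κ z.1 * ⟪u z.1 z.2, fderiv ℝ g z.2 a • c - fderiv ℝ g z.2 c • a⟫ = 0)
    {K m r₀ : ℝ} (hm : m < 3)
    (hgrowth : ∀ r : ℝ, r₀ < r → 0 < r →
      ∫⁻ x in ball (0 : EuclideanSpace ℝ (Fin 3)) r, ‖∫ t, κ t • u t x‖ₑ ^ 2 ≤ ENNReal.ofReal (K * r ^ m)) :
    (fun x => ∫ t, κ t • u t x) =ᵐ[volume] (0 : EuclideanSpace ℝ (Fin 3) → EuclideanSpace ℝ (Fin 3)) := by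
  set w : EuclideanSpace ℝ (Fin 3) → EuclideanSpace ℝ (Fin 3) := fun x => ∫ t, κ t • u t x with hw
  have hwl : LocallyIntegrable w volume := locallyIntegrable_timeTested hu hκ hκc hκT
  have hwdiv : IsWeaklyDivFree w := by
    intro g hg
    obtain ⟨hgc, hgs⟩ := gradient_test_props hg
    show ∫ x, ⟪(∫ t, κ t • u t x), gradient g x⟫ = 0
    rw [integral_inner_timeTested hu hκ hκc hκT hgc hgs]
    exact hdiv g hg
  have hwcurl : ∀ g : EuclideanSpace ℝ (Fin 3) → ℝ, IsTestFunctionOn (⊤ : Opens (EuclideanSpace ℝ (Fin 3))) g →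
      ∀ a c : EuclideanSpace ℝ (Fin 3), ∫ x, ⟪w x, fderiv ℝ g x a • c - fderiv ℝ g x c • a⟫ = 0 := by
    intro g hg a c
    have hT := isTestFunctionOn_curlPair hg a c
    show ∫ x, ⟪(∫ t, κ t • u t x), fderiv ℝ g x a • c - fderiv ℝ g x c • a⟫ = 0
    rw [integral_inner_timeTested hu hκ hκc hκT hT.contDiff.continuous hT.hasCompactSupport]
    exact hcurl g hg a c
  -- adapted from Theorems/EulerZoomLiouvillePowerGaugeEulerLiouvilleIrrotationalTools.lean (`ae_eq_zero_of_symm_traceFree_of_growth`)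
  have hcoord : ∀ i : Fin 3, (fun x => ⟪w x, EuclideanSpace.single i (1 : ℝ)⟫) =ᵐ[volume] 0 := by
    intro i
    set a : (EuclideanSpace ℝ (Fin 3)) := EuclideanSpace.single i (1 : ℝ) with ha
    have ha1 : ‖a‖ = 1 := by
      rw [ha, PiLp.norm_single, norm_one]
    refine ae_eq_zero_of_weaklyHarmonic_of_growth (K := K) (m := m) (r₀ := r₀) ?_ ?_ hm ?_
    · have e1 : (fun x => ⟪w x, a⟫) = fun x => (innerSL ℝ a) (w x) := by
        funext x; simp only [innerSL_apply_apply, real_inner_comm]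
      rw [e1, ← locallyIntegrableOn_univ]
      exact (innerSL ℝ a).locallyIntegrableOn_comp (locallyIntegrableOn_univ.2 hwl)
    · intro φ hφ hφc
      have hθ : IsTestFunctionOn (⊤ : Opens (EuclideanSpace ℝ (Fin 3))) φ := ⟨hφ, hφc, by simp⟩
      have := integral_laplacian_mul_inner_eq_zero_of_curlPair hwl hwdiv hwcurl hθ a
      rw [← this]
      exact integral_congr_ae (Eventually.of_forall fun x => by simp only [mul_comm])
    · intro r hr hr0
      refine le_trans (lintegral_mono fun x => ?_) (hgrowth r hr hr0)
      gcongr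
      rw [← ofReal_norm, ← ofReal_norm]
      exact ENNReal.ofReal_le_ofReal ((norm_inner_le_norm _ _).trans (by rw [ha1, mul_one]))
  have hall := ae_all_iff.2 hcoord
  filter_upwards [hall] with x hx
  ext i
  have h1 := hx i
  simp only [Pi.zero_apply] at h1
  rw [EuclideanSpace.inner_single_right] at h1
  simpa using h1

end AntiMember

end Summit.NavierStokesRegularity.NavierStokesRegularity.Theorems.PowerGaugeEulerLiouville

end
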